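import Literature.NumberTheory.EllipticCurves.Rank1Residual.Typed.Basic
import HarnessLib

/-!
# Class X5 (`p = 2`, beyond a sharp `2`-descent) — TYPED missing input (cell `b2b-bsdres`)

HONEST FRAMING (run/shared/lean/b2b/bsd-rank1-residual/): construction-shaped classes are TYPED
(missing input named; required output at `(E,2)` stated), NOT attempted; this is not "finishing BSD".

**Class X5** (RESIDUAL-CASES §a.2 v3; `Rank1Residual.ClassX5 W p := p = 2`): the `2`-part for a
general `E/ℚ` of analytic rank `≤ 1`. Per curve a complete `2`-descent with the Cassels pairing
(census row T-2DESC / C13) decides `BSD(E,2)` whenever the `2`-Selmer bound is sharp (`r₂ = r`); the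
class residue is `r₂ > r` (`Ш[4] ≠ Ш[2]`), e.g. `1309a1, 2045b1` (`#Ш_an = 16`). Census v3: 2 pairs
with `N < 2500`, 10 with `N < 10⁴`. Label: CONSTRUCTION-SHAPED (high).

**What kind of object is missing.** An Iwasawa main conjecture / Euler-system divisibility at
`p = 2` WITH a control theorem to the leading term, for general `E/ℚ`: at `2` the `2`-adic
`L`-function, the image of Galois and the local conditions all degenerate; Skinner–Urban 2014, Kato's
Thm. 17.4 clause (3), Burungale–Castella–Skinner 2025, Jetchev–Skinner–Wan 2017 and the non-CM inputs
of Burungale–Flach 2024 all require `p` odd.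

**Closest published results (families only), and why they do not reach the class.** Tian, Camb. J.
Math. 2 (2014) (congruent number curves); Coates–Li–Tian–Zhai, Proc. LMS 110 (2015); Cai–Li–Zhai,
J. LMS 101 (2020) — `2`-part of BSD for explicit quadratic-twist families (CM or specific curves) by
explicit `2`-descent and induction on the prime factors of the twist; Burungale–Flach 2024 gives
the full formula incl. `p = 2` for CM curves of analytic rank `0` (class X0, closed). None is a
statement about a general `E`. Per curve: higher descents (`4`-, `8`-descent, Fisher; second
`2`-isogeny descents, Creutz–Miller, J. Algebra 372 (2012)) settle `ord₂ #Ш`; for `N < 5000` every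
pair is decided in print (Creutz–Miller Thm. 1.1).

This file: `X5.MissingInputAt W p := MissingPPartAt W p` (at `p = 2`) and the conditional class
theorem. The class-wide statement is not a Literature statement; recorded in CLASSES.md.
-/

noncomputable section

open scoped Classical

open WeierstrassCurve Literature.NumberTheory.EllipticCurves
  Literature.NumberTheory.EllipticCurves.Rank1Residual

namespace Literature.NumberTheory.EllipticCurves.Rank1Residual.Typed

/-- **X5 — the missing input at `(E, 2)`, typed**: no `2`-adic IMC-with-control for a general `E/ℚ`
is in print (all published `p`-part theorems need `p` odd; the `2`-part is known only for explicit
CM / quadratic-twist families — Tian 2014, Coates–Li–Tian–Zhai 2015, Cai–Li–Zhai 2020 — and per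
curve by higher descents), so the missing input is the whole output `MissingPPartAt W 2`. Nothing
asserted. [cite: CreutzMiller2012, Thm. 1.1 (per-curve 2-parts for N < 5000) (shape only; nothing asserted)] [cite: SkinnerUrban2014, Thm. 2 (p odd) (shape only; nothing asserted)] -/
def X5.MissingInputAt (W : WeierstrassCurve ℚ) (p : ℕ) : Prop := MissingPPartAt W p

/-- **X5 conditional class theorem**: in analytic rank `≤ 1`, the typed missing input at `(E, 2)`
yields Miller's `BSD(E,2)`. [cite: Miller2011LMS, §1 and Def. 1.1] -/
theorem X5.bsdp_of_missingInputAt (hGZK : rank_eq_analyticRank_of_analyticRank_le_one)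
    (W : WeierstrassCurve ℚ) [W.IsElliptic] [W.IsGloballyMinimal] (p : ℕ) [Fact p.Prime]
    (hr : W.analyticRank ≤ 1) (_hX : ClassX5 W p) (hmiss : X5.MissingInputAt W p) : BSDp W p :=
  bsdp_of_missingPPartAt W p hGZK hr hmiss

end Literature.NumberTheory.EllipticCurves.Rank1Residual.Typed
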